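import Mathlib
import HarnessLib
import Literature.Computability.AlgebraicComplexity.NilCoxeterTensor
import Literature.Computability.AlgebraicComplexity.SchoenhageTauProofs
import Summits.MatrixMultiplication.MatrixMultiplication.Theses.NilCoxeterShadow
import Summits.MatrixMultiplication.MatrixMultiplication.Theorems.NilCoxeterShadowOmegaTwoGroupAlgebraRank

/-!
# Crux `AThesis` (stmt-MatrixMultiplication-0956) — `Lines/rank-gap.lean` (strategist line)

Route `NilCoxeterShadow` (route-MatrixMultiplication-NilCoxeterShadow, REFUTATION line:
`closes : AThesis → DegenerationTransfer → OmegaTwoGroupAlgebraRank → ¬ MatrixMultiplication`, both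
supports PROVED; `AThesis` is the one open load-bearing leaf).

Write `R n := R(T_{NC_n}) = tensorRank (nilCoxeterTensor ℂ n)` (RANK) and
`b n := bR(T_{NC_n}) = algBorderRank (nilCoxeterTensor ℂ n)` (border rank over `ℂ[ε]`, Bläser 2013
Def. 6.1); the route file inlines `nilCoxeterTensor` verbatim (`nilCoxeterTensor_eq` is `rfl`), so

  `AThesis : ∃ δ > 0, ∀ n₀, ∃ n ≥ n₀, (n!)^(1+δ) ≤ b n`.

THE LINE = the LANGUAGE SWITCH border rank → rank ("rank–gap"):

* `stub_superlinearRank` — the RANK thesis `∃ δ > 0, ∀ n₀, ∃ n ≥ n₀, (n!)^(1+δ) ≤ R n`: a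
  super-linear lower bound for the RANK of the explicit tensor family `T_{NC_n}`. A CONSEQUENCE of the
  crux (`b n ≤ R n`, `algBorderRank_le_tensorRank`), conjecturally strictly weaker, and the place where
  the existing traction on `NC_n` lives: Bläser's radical theorem gives `R n ≥ 3·n! − o(n!)`
  (Landsberg 2017 Thm 5.6.3.2 with `Rad^k = span{T_w : inv w ≥ k}`), Alder–Strassen `R n ≥ 2·n! − 1`
  (one maximal ideal), versus only `b n ≥ n! + 1` on the border side (Bläser–Lysikov 2016); rank lower
  bounds are not subject to the cactus barrier (`Literature.Barriers.MatrixMultiplication.LinearRankMethodBarrier`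
  caps linear rank methods for rank too, EGOW Thm 4.4: `≤ 8N`, but the substitution method and the
  associative-algebra bounds are outside that class). Size XL / open: an explicit tensor with
  `R ≥ (3+ε)m` is already Bläser's open Problem (Landsberg 2017, Problem 5.3.1.9), and `R ≥ m^(1+δ)`
  for an explicit bilinear map is a super-linear arithmetic-circuit lower bound (Strassen: `L ≥ R/2`).
* `stub_debordering` — DEBORDERING for the nil-Coxeter family: `∀ η > 0, ∀ᶠ n, R n ≤ (n!)^η · b n`,
  i.e. the rank/border-rank gap of `T_{NC_n}` is sub-power in the dimension `n!`. Equivalently (up to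
  the `(n!)^{o(1)}` slack, by Bläser 2013 Lemma 6.4 `R ≤ C(h+2,2)·R_h`, in tree as
  `tensorRank_le_choose_mul_approxRank`): approximation ORDER `poly(n) = polylog(dim)` is
  `(n!)^{o(1)}`-optimal for `T_{NC_n}`. TRUE in the `ω = 2` world (then `n! ≤ b n ≤ R n ≤ n⁴·R(ℂ[S_n])
  ≤ (n!)^{1+o(1)}`, see `tensorRank_nilCoxeterTensor_le` below); open in general — the general order
  bound is exponential (Lehmkuhl–Lickteig 1989, `Literature/…/ApproximationOrderBound.lean`; Zuiddam
  2017: `R/bR ≤ 2·9^{(m−1)bR}+1`; whether a polynomial order bound exists is open,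
  Dutta–Dwivedi–Saxena FOCS 2021 §1.3), the largest known ratios `R/bR` are `3 − o(1)` (Landsberg 2017
  Cor 5.6.3.7 / 5.6.3.9) and `R_max ≤ 2·bR_max` (Buczyński–Teitler, Landsberg 2017 Thm 5.6.3.11).
* `io_superpoly_of_gap` — the sorry-free real-analysis core: an infinitely-often bound
  `f n ^ (1+δ) ≤ R n` survives a sub-power gap `R n ≤ f n ^ η · b n` (all `η > 0`, eventually) as
  `f n ^ (1+δ/2) ≤ b n` infinitely often.
* `AThesis_of : AThesis` — THE skeleton theorem: the crux BY NAME from the two declared stubs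
  (`sorry` occurs ONLY inside the two `stub_*`).

SIDE THEOREMS (sorry-free, NOT used by `AThesis_of`, no dependence on any stub): the rank-level
transfer `tensorRank_nilCoxeterTensor_le : R(T_{NC_n}) ≤ C(n(n−1)/2 + 2, 2) · R(T_{ℂ[S_n]})`
(Rees degeneration of order `h = n(n−1)/2`, `approxRank_nilCoxeterTensor_le`, composed with Bläser's
Lemma 6.4) and `not_matrixMultiplication_of_superlinearRank : (statement of stub 1) → ¬ MatrixMultiplication`.
So the RANK thesis ALONE already decides the summit: the route's thesis can be WEAKENED from border
rank to rank at no cost (recommendation to the tenure planner: add the rank thesis as an item with the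
deciding theorem below as its `closes`). This corrects the crux-attack note of 2026-08-17 ("rank variant
… would not transfer to ω"): it transfers, because the Rees degeneration has polynomial order.

Disproof used: no `Disproof.lean` / `Negative/` lemma exists for this crux (2026-08-17); `ledger
negatives --problem MatrixMultiplication` (9 entries) has nothing on `nilCoxeterTensor` or group-algebra
rank. Kill inherited from the route: `PolynomialExcess` (stmt-0960) refutes the crux (not stub 1
directly: it bounds `b`, and refutes stub 1 only together with stub 2); `ω = 2` refutes stub 1 (side
theorem) and the crux.
-/

-- `Summit.<Summit>.<Problem>`: for the single-conjunct summit the duplicate component is mandated.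
set_option linter.dupNamespace false

namespace Summit.MatrixMultiplication.MatrixMultiplication.Cruxes.AThesis.RankGap

open Literature.Computability.AlgebraicComplexity
open Summit.MatrixMultiplication.MatrixMultiplication.Theses.NilCoxeterShadow

/-! ## The two registered stubs -/

/-- **Stub 1 — the RANK thesis (super-linear rank of the nil-Coxeter tensor, infinitely often):**
`∃ δ > 0, ∀ n₀, ∃ n ≥ n₀, (n!)^(1+δ) ≤ R(T_{NC_n})`. A consequence of the crux (`bR ≤ R`); the
converse is open. Why plausibly true: it is the route's bet read one level down, where `NC_n` already
shows traction (`R ≥ 3·n! − o(n!)` by Bläser's radical theorem; border side only `n! + 1`); false if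
`ω = 2` (`not_matrixMultiplication_of_superlinearRank`). Size XL / open — beyond Bläser's explicit
`(3+ε)m` problem; equivalent to a super-linear circuit lower bound for the explicit bilinear map
"multiplication in `NC_n`". Sources: Landsberg2017 (Thm 5.6.3.2, Rem 5.6.3.5, Problem 5.3.1.9),
Blaser2014 (Explicit tensors), AlexeevForbesTsimerman2011, EfremenkoGargOliveiraWigderson2018 (Thm 4.4),
Raz2013 (J. ACM 60(6), tensor rank and formulas). -/
theorem stub_superlinearRank :
    ∃ δ : ℝ, 0 < δ ∧ ∀ n₀ : ℕ, ∃ n : ℕ, n₀ ≤ n ∧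
      (n.factorial : ℝ) ^ (1 + δ) ≤ (tensorRank (nilCoxeterTensor ℂ n) : ℝ) := by
  sorry

/-- **Stub 2 — debordering of the nil-Coxeter family (sub-power rank/border-rank gap):**
`∀ η > 0, ∀ᶠ n, R(T_{NC_n}) ≤ (n!)^η · bR(T_{NC_n})`. Why plausibly true: it HOLDS if `ω = 2`
(both sides are `(n!)^{1+o(1)}`: `n! ≤ bR`, `R ≤ n⁴ R(ℂ[S_n])` by `tensorRank_nilCoxeterTensor_le`), it
holds for every tensor family whose optimal border decompositions have approximation order
`poly(n)` (Bläser 2013 Lemma 6.4), and no tensor family with `R/bR → ∞` is known (records `3 − o(1)`);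
why it might fail: in the `ω > 2` world `bR(T_{NC_n})` and `R(T_{NC_n})` could sit at different
exponents in `[1, ω/2]`, and the only general order bound is exponential (Lehmkuhl–Lickteig 1989).
Size XL / open, structural (geometry of the orbit closure at a torus-graded 0/1 monomial tensor).
Sources: Blaser2013 (Lemma 6.4), LehmkuhlLickteig1989, Zuiddam2017 (LAA 525), Landsberg2017
(Cor 5.6.3.7, Thm 5.6.3.11), DuttaDwivediSaxena2021 (debordering, §1.3). -/
theorem stub_debordering :
    ∀ η : ℝ, 0 < η → ∀ᶠ n : ℕ in Filter.atTop,
      (tensorRank (nilCoxeterTensor ℂ n) : ℝ) ≤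
        (n.factorial : ℝ) ^ η * (algBorderRank (nilCoxeterTensor ℂ n) : ℝ) := by
  sorry

/-! ## Definitional bridge (sorry-free): the route decl is the `nilCoxeterTensor` form, by `rfl` -/

/-- `AThesis` unfolded over `nilCoxeterTensor ℂ` (the route file inlines the tensor and the inversion
number; `nilCoxeterTensor_eq` is `rfl`). [folklore] -/
theorem aThesis_iff :
    Summit.MatrixMultiplication.MatrixMultiplication.Theses.NilCoxeterShadow.AThesis ↔
      ∃ δ : ℝ, 0 < δ ∧ ∀ n₀ : ℕ, ∃ n : ℕ, n₀ ≤ n ∧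
        (n.factorial : ℝ) ^ (1 + δ) ≤ (algBorderRank (nilCoxeterTensor ℂ n) : ℝ) :=
  Iff.rfl

/-! ## Sorry-free core: an i.o. super-polynomial bound survives a sub-power gap -/

/-- **Gap lemma** (pure real analysis). If `1 ≤ f n`, `f n ^ (1+δ) ≤ R n` for infinitely many `n`
(`δ > 0`) and, for every `η > 0`, eventually `R n ≤ f n ^ η · b n`, then `f n ^ (1+δ/2) ≤ b n` for
infinitely many `n`: at `η = δ/2`, `f^(δ/2) · f^(1+δ/2) = f^(1+δ) ≤ R ≤ f^(δ/2) · b`, cancel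
`f^(δ/2) > 0`. [folklore] -/
theorem io_superpoly_of_gap (f R b : ℕ → ℝ) (hf : ∀ n, 1 ≤ f n)
    (hR : ∃ δ : ℝ, 0 < δ ∧ ∀ n₀ : ℕ, ∃ n : ℕ, n₀ ≤ n ∧ f n ^ (1 + δ) ≤ R n)
    (hgap : ∀ η : ℝ, 0 < η → ∀ᶠ n : ℕ in Filter.atTop, R n ≤ f n ^ η * b n) :
    ∃ δ : ℝ, 0 < δ ∧ ∀ n₀ : ℕ, ∃ n : ℕ, n₀ ≤ n ∧ f n ^ (1 + δ) ≤ b n := by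
  obtain ⟨δ, hδ, hio⟩ := hR
  refine ⟨δ / 2, half_pos hδ, fun n₀ => ?_⟩
  obtain ⟨N, hN⟩ := Filter.eventually_atTop.1 (hgap (δ / 2) (half_pos hδ))
  obtain ⟨n, hn, hRn⟩ := hio (max n₀ N)
  refine ⟨n, (le_max_left _ _).trans hn, ?_⟩
  have hgn : R n ≤ f n ^ (δ / 2) * b n := hN n ((le_max_right _ _).trans hn)
  have hfpos : 0 < f n := lt_of_lt_of_le one_pos (hf n)
  have key : f n ^ (δ / 2) * f n ^ (1 + δ / 2) ≤ f n ^ (δ / 2) * b n := by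
    calc f n ^ (δ / 2) * f n ^ (1 + δ / 2) = f n ^ (1 + δ) := by
          rw [← Real.rpow_add hfpos]
          congr 1
          ring
      _ ≤ R n := hRn
      _ ≤ f n ^ (δ / 2) * b n := hgn
  exact le_of_mul_le_mul_left key (Real.rpow_pos_of_pos hfpos _)

/-! ## The composition: the two stubs prove the crux BY NAME -/

/-- **Composition with explicit hypotheses** (the shape `stub₁-sig → stub₂-sig → crux`, conclusion the
one-step unfolding of `AThesis` over `nilCoxeterTensor ℂ`). Sorry-free, standard axioms. [folklore] -/
theorem aThesis_of_superlinearRank_of_debordering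
    (hrank : ∃ δ : ℝ, 0 < δ ∧ ∀ n₀ : ℕ, ∃ n : ℕ, n₀ ≤ n ∧
      (n.factorial : ℝ) ^ (1 + δ) ≤ (tensorRank (nilCoxeterTensor ℂ n) : ℝ))
    (hgap : ∀ η : ℝ, 0 < η → ∀ᶠ n : ℕ in Filter.atTop,
      (tensorRank (nilCoxeterTensor ℂ n) : ℝ) ≤
        (n.factorial : ℝ) ^ η * (algBorderRank (nilCoxeterTensor ℂ n) : ℝ)) :
    ∃ δ : ℝ, 0 < δ ∧ ∀ n₀ : ℕ, ∃ n : ℕ, n₀ ≤ n ∧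
      (n.factorial : ℝ) ^ (1 + δ) ≤ (algBorderRank (nilCoxeterTensor ℂ n) : ℝ) :=
  io_superpoly_of_gap (fun n => (n.factorial : ℝ)) (fun n => (tensorRank (nilCoxeterTensor ℂ n) : ℝ))
    (fun n => (algBorderRank (nilCoxeterTensor ℂ n) : ℝ))
    (fun n => by exact_mod_cast Nat.succ_le_of_lt n.factorial_pos) hrank hgap

/-- **THE SKELETON THEOREM.** The crux `Summit.MatrixMultiplication.MatrixMultiplication.Theses.NilCoxeterShadow.AThesis`
(stmt-MatrixMultiplication-0956), concluded BY NAME from the two DECLARED stubs `stub_superlinearRank`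
and `stub_debordering` (the only `sorry`s of the file) through the sorry-free gap lemma and the `rfl`
bridge. [folklore] -/
theorem AThesis_of : Summit.MatrixMultiplication.MatrixMultiplication.Theses.NilCoxeterShadow.AThesis :=
  aThesis_iff.mpr (aThesis_of_superlinearRank_of_debordering stub_superlinearRank stub_debordering)

/-! ## Side theorems (sorry-free; not used by `AThesis_of`): the rank thesis alone refutes `ω(ℂ) = 2` -/

/-- **Stub 1 is NECESSARY for the crux**: `AThesis →` (statement of `stub_superlinearRank`), since
`bR ≤ R` (`algBorderRank_le_tensorRank`). So the line replaces the crux by a consequence of it plus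
the debordering gap; the converse of this theorem is open. [folklore] -/
theorem superlinearRank_of_aThesis
    (h : Summit.MatrixMultiplication.MatrixMultiplication.Theses.NilCoxeterShadow.AThesis) :
    ∃ δ : ℝ, 0 < δ ∧ ∀ n₀ : ℕ, ∃ n : ℕ, n₀ ≤ n ∧
      (n.factorial : ℝ) ^ (1 + δ) ≤ (tensorRank (nilCoxeterTensor ℂ n) : ℝ) := by
  obtain ⟨δ, hδ, hio⟩ := aThesis_iff.mp h
  refine ⟨δ, hδ, fun n₀ => ?_⟩
  obtain ⟨n, hn, hle⟩ := hio n₀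
  refine ⟨n, hn, hle.trans ?_⟩
  exact_mod_cast algBorderRank_le_tensorRank (nilCoxeterTensor ℂ n)

/-- **Rank-level degeneration transfer** `R(T_{NC_n}) ≤ C(n(n−1)/2 + 2, 2) · R(T_{ℂ[S_n]})`: the Rees
twist of an optimal exact decomposition of the group tensor is an order-`h` approximate decomposition
of `T_{NC_n}` with `h = n(n−1)/2` (`approxRank_nilCoxeterTensor_le`, Bläser–Lysikov 2016 §2.3), and
an order-`h` approximate decomposition with `r` triads yields an exact one with `C(h+2,2)·r` triads
(Bläser 2013, Lemma 6.4, `tensorRank_le_choose_mul_approxRank`). The point: the order is POLYNOMIAL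
in `n`, i.e. `(n!)^{o(1)}`. [cite: Blaser2013, Lemma 6.4] [cite: BlaserLysikov2016, §2.3, Lemma 4] -/
theorem tensorRank_nilCoxeterTensor_le (n : ℕ) :
    tensorRank (nilCoxeterTensor ℂ n) ≤
      (n * (n - 1) / 2 + 2).choose 2 * tensorRank (groupTensor ℂ (Equiv.Perm (Fin n))) :=
  (tensorRank_le_choose_mul_approxRank (n * (n - 1) / 2) (nilCoxeterTensor ℂ n)).trans
    (Nat.mul_le_mul_left _ (approxRank_nilCoxeterTensor_le ℂ n))

/-- `C(n(n−1)/2 + 2, 2) ≤ n⁴` for `n ≥ 2` (crude: `C(m,2) ≤ m²` and `n(n−1)/2 + 2 ≤ n²`). [folklore] -/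
theorem choose_order_le_pow_four {n : ℕ} (hn : 2 ≤ n) : (n * (n - 1) / 2 + 2).choose 2 ≤ n ^ 4 := by
  set m := n * (n - 1) / 2 + 2 with hm
  have h1 : m.choose 2 ≤ m * m := by
    rw [Nat.choose_two_right]
    exact (Nat.div_le_self _ _).trans (Nat.mul_le_mul_left _ (Nat.sub_le _ _))
  have h2 : m ≤ n * n := by
    have h3 : n * (n - 1) / 2 ≤ n * (n - 1) := Nat.div_le_self _ _
    have h4 : n * (n - 1) + 2 ≤ n * n := by
      obtain ⟨k, rfl⟩ := Nat.exists_eq_add_of_le hn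
      rw [show 2 + k - 1 = k + 1 by omega]
      nlinarith
    omega
  calc m.choose 2 ≤ m * m := h1
    _ ≤ (n * n) * (n * n) := Nat.mul_le_mul h2 h2
    _ = n ^ 4 := by ring

/-- `n^k ≤ 2^k · n!` for `n ≥ 2k` (from `(n+1−k)^k ≤ n!/(n−k)!`, Mathlib's
`Nat.pow_sub_le_descFactorial`, and `n ≤ 2(n+1−k)`). [folklore] -/
theorem pow_le_two_pow_mul_factorial {k n : ℕ} (h : 2 * k ≤ n) : n ^ k ≤ 2 ^ k * n.factorial := by
  have hk : k ≤ n := by omega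
  have h1 : n ≤ 2 * (n + 1 - k) := by omega
  have h2 : n.descFactorial k ≤ n.factorial := by
    rw [← Nat.factorial_mul_descFactorial hk]
    exact Nat.le_mul_of_pos_left _ (Nat.factorial_pos _)
  calc n ^ k ≤ (2 * (n + 1 - k)) ^ k := Nat.pow_le_pow_left h1 k
    _ = 2 ^ k * (n + 1 - k) ^ k := by rw [mul_pow]
    _ ≤ 2 ^ k * n.descFactorial k := Nat.mul_le_mul_left _ (Nat.pow_sub_le_descFactorial n k)
    _ ≤ 2 ^ k * n.factorial := Nat.mul_le_mul_left _ h2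

/-- **The rank thesis alone refutes `ω(ℂ) = 2`** (turnkey weaker thesis for the route). From
`ω = 2`: `R(T_{ℂ[S_n]}) ≤ C·(n!)^{1+δ/2}` (`omegaTwoGroupAlgebraRank_proof`, PROVED route support,
Wedderburn + `ω`), so `R(T_{NC_n}) ≤ n⁴·C·(n!)^{1+δ/2}` (`tensorRank_nilCoxeterTensor_le`); with the
rank thesis, `(n!)^{δ/2} ≤ C·n⁴` for infinitely many `n` — absurd, since `n⁵ ≤ 2^{kδ/2}·(n!)^{δ/2}`
for `k ≥ 10/δ` and `n ≥ 2k` (`pow_le_two_pow_mul_factorial`). Sorry-free; the hypothesis is the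
statement of `stub_superlinearRank`, NOT the stub. [folklore] -/
theorem not_matrixMultiplication_of_superlinearRank
    (hrank : ∃ δ : ℝ, 0 < δ ∧ ∀ n₀ : ℕ, ∃ n : ℕ, n₀ ≤ n ∧
      (n.factorial : ℝ) ^ (1 + δ) ≤ (tensorRank (nilCoxeterTensor ℂ n) : ℝ)) :
    ¬ _root_.MatrixMultiplication := by
  intro hMM
  obtain ⟨δ, hδ, hio⟩ := hrank
  obtain ⟨C, hC⟩ :=
    Summit.MatrixMultiplication.MatrixMultiplication.Theorems.omegaTwoGroupAlgebraRank_proof hMM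
      (δ / 2) (half_pos hδ)
  -- an exponent `k` with `5 ≤ k·δ/2`
  obtain ⟨k, hk⟩ := exists_nat_ge (10 / δ)
  have hkδ : (5 : ℝ) ≤ (k : ℝ) * (δ / 2) := by
    have : 10 / δ * (δ / 2) = 5 := by field_simp; ring
    rw [← this]
    exact mul_le_mul_of_nonneg_right hk (by positivity)
  -- the constant beyond which the infinitely-often instance is impossible
  set K : ℝ := ((2 : ℝ) ^ k) ^ (δ / 2) with hK
  have hKpos : 0 < K := Real.rpow_pos_of_pos (by positivity) _
  obtain ⟨N, hN⟩ := exists_nat_gt (K * max C 1)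
  obtain ⟨n, hn, hRn⟩ := hio (max N (2 * k + 2))
  have hnN : N ≤ n := (le_max_left _ _).trans hn
  have hn2k : 2 * k ≤ n := by have := (le_max_right _ _).trans hn; omega
  have hn2 : 2 ≤ n := by have := (le_max_right _ _).trans hn; omega
  have hnpos : (0 : ℝ) < n := by exact_mod_cast (show 0 < n by omega)
  have hn1 : (1 : ℝ) ≤ n := by exact_mod_cast (show 1 ≤ n by omega)
  have hfpos : (0 : ℝ) < (n.factorial : ℝ) := by exact_mod_cast n.factorial_pos
  -- (1) `R(T_{NC_n}) ≤ n⁴ · C · (n!)^{1+δ/2}`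
  have hS := hC (Equiv.Perm (Fin n))
  rw [Fintype.card_perm, Fintype.card_fin] at hS
  have hT : (tensorRank (nilCoxeterTensor ℂ n) : ℝ) ≤
      (n : ℝ) ^ 4 * (C * (n.factorial : ℝ) ^ (1 + δ / 2)) := by
    have h1 : (tensorRank (nilCoxeterTensor ℂ n) : ℝ) ≤
        ((n * (n - 1) / 2 + 2).choose 2 : ℝ) * (tensorRank (groupTensor ℂ (Equiv.Perm (Fin n))) : ℝ) := by
      exact_mod_cast tensorRank_nilCoxeterTensor_le n
    have h2 : ((n * (n - 1) / 2 + 2).choose 2 : ℝ) ≤ (n : ℝ) ^ 4 := by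
      exact_mod_cast choose_order_le_pow_four hn2
    have h3 : (0 : ℝ) ≤ (tensorRank (groupTensor ℂ (Equiv.Perm (Fin n))) : ℝ) := Nat.cast_nonneg _
    calc (tensorRank (nilCoxeterTensor ℂ n) : ℝ)
        ≤ ((n * (n - 1) / 2 + 2).choose 2 : ℝ) * (tensorRank (groupTensor ℂ (Equiv.Perm (Fin n))) : ℝ) := h1
      _ ≤ (n : ℝ) ^ 4 * (tensorRank (groupTensor ℂ (Equiv.Perm (Fin n))) : ℝ) :=
          mul_le_mul_of_nonneg_right h2 h3
      _ ≤ (n : ℝ) ^ 4 * (C * (n.factorial : ℝ) ^ (1 + δ / 2)) :=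
          mul_le_mul_of_nonneg_left hS (by positivity)
  -- (2) hence `(n!)^{δ/2} ≤ n⁴ · C`, so `C > 0`
  have hmain : (n.factorial : ℝ) ^ (δ / 2) ≤ (n : ℝ) ^ 4 * C := by
    have h1 : (n.factorial : ℝ) ^ (δ / 2) * (n.factorial : ℝ) ^ (1 + δ / 2) ≤
        ((n : ℝ) ^ 4 * C) * (n.factorial : ℝ) ^ (1 + δ / 2) := by
      calc (n.factorial : ℝ) ^ (δ / 2) * (n.factorial : ℝ) ^ (1 + δ / 2)
          = (n.factorial : ℝ) ^ (1 + δ) := by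
            rw [← Real.rpow_add hfpos]
            congr 1
            ring
        _ ≤ (tensorRank (nilCoxeterTensor ℂ n) : ℝ) := hRn
        _ ≤ (n : ℝ) ^ 4 * (C * (n.factorial : ℝ) ^ (1 + δ / 2)) := hT
        _ = ((n : ℝ) ^ 4 * C) * (n.factorial : ℝ) ^ (1 + δ / 2) := by ring
    exact le_of_mul_le_mul_right h1 (Real.rpow_pos_of_pos hfpos _)
  -- (3) but `n⁵ ≤ K · (n!)^{δ/2}`
  have hpoly : (n : ℝ) ^ 5 ≤ K * (n.factorial : ℝ) ^ (δ / 2) := by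
    have h1 : ((n : ℝ) ^ k) ≤ (2 : ℝ) ^ k * (n.factorial : ℝ) := by
      exact_mod_cast pow_le_two_pow_mul_factorial hn2k
    have h2 : ((n : ℝ) ^ k) ^ (δ / 2) ≤ ((2 : ℝ) ^ k * (n.factorial : ℝ)) ^ (δ / 2) :=
      Real.rpow_le_rpow (by positivity) h1 (by positivity)
    rw [Real.mul_rpow (by positivity) hfpos.le] at h2
    have h3 : (n : ℝ) ^ 5 ≤ ((n : ℝ) ^ k) ^ (δ / 2) := by
      rw [← Real.rpow_natCast (n : ℝ) k, ← Real.rpow_mul hnpos.le, ← Real.rpow_natCast (n : ℝ) 5]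
      exact Real.rpow_le_rpow_of_exponent_le hn1 (by exact_mod_cast hkδ)
    exact h3.trans h2
  -- (4) combine: `n⁵ ≤ K · n⁴ · C`, i.e. `n ≤ K · C < N ≤ n`
  have h4pos : (0 : ℝ) < (n : ℝ) ^ 4 := by positivity
  have hcomb : (n : ℝ) * (n : ℝ) ^ 4 ≤ (K * C) * (n : ℝ) ^ 4 := by
    calc (n : ℝ) * (n : ℝ) ^ 4 = (n : ℝ) ^ 5 := by ring
      _ ≤ K * (n.factorial : ℝ) ^ (δ / 2) := hpoly
      _ ≤ K * ((n : ℝ) ^ 4 * C) := mul_le_mul_of_nonneg_left hmain hKpos.le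
      _ = (K * C) * (n : ℝ) ^ 4 := by ring
  have hle : (n : ℝ) ≤ K * C := le_of_mul_le_mul_right hcomb h4pos
  have hKC : K * C ≤ K * max C 1 := mul_le_mul_of_nonneg_left (le_max_left _ _) hKpos.le
  have hNn : (N : ℝ) ≤ n := by exact_mod_cast hnN
  linarith

end Summit.MatrixMultiplication.MatrixMultiplication.Cruxes.AThesis.RankGap
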